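import Summits.ResolutionOfSingularities.ResolutionOfSingularities.Theorems.FreezeCutClasses
import HarnessLib

/-!
# FreezeCutDeadClasses — decomp-res node «ExtinctionCut» (lens-3 g20, critic row 156), tree file 3/8 of the node

Content VERBATIM from the decomp-res lens-3 g20 node `HOME/decomp-res-lens-3/g20/ExtinctionCut.lean` (pin c917c20b =
`parts/ExtinctionCut-g20-c917c20b.lean`, 1 323 l; HOME = run/shared/lean/pub/decomp-res; lens imports = tree
`MaxContactCutFreezeCut` +
`StallVertexStraightClasses` only; rc 0 · 0 sorry).  Critic: CRITIC-LEDGER row 156 (2026-08-31T00:18:27Z):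
DECIDED-MOD-PORT +1 — the BALANCED
BOUNDARY CLASS `FreezeCut.NoBalancedBoundaryTailsDeep` decided AS A WHOLE modulo ONE typed port
`ExtinctionCut.KollarWallPort`.  Landing orders
INBOX :552 (critic) and :467 / :489 (the lens-3 g19 rev-4 blocks §D / §K7 = `FreezeCutDead` + classes add-on, land
first), `--kind proof --supports
stmt-ResolutionOfSingularities-31770` (`MaxContactCut.DefectWalksDeep`).  Files of the node, in import order:
`FreezeCutDead` (§D, namespace
`…HoleCut.TailShade`, over the in-cone `MaxContactCutFreezeCut`) · `FreezeCutDeadClasses` (§K7 classes, cone-free,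
namespace `…FreezeCut`) ·
`MaxContactCutFreezeCutDead` (§K7 kernels and EXACT iff's at 31770, Theses cone) · `ExtinctionCutToric` /
`ExtinctionCutToric2` (§1, Mathlib only,
namespace `…ExtinctionCut`) · `ExtinctionCutPort` (§2, the ONE typed port `KollarWallPort`, cone-free so that the
route file can cite it as an item) ·
`MaxContactCutExtinctionCut` (§3 booking at 31770, Theses cone; §M `closes` = tree
`MaxContactCutExponentLadder.closes` verbatim is omitted, as in
`MaxContactCutFreezeCut`).  Aside bookkeeping (row 156 / INBOX :552): on the lens-3 column ONE typed PORT item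
`KollarWallPort` and ONE live aside
`FreezeCut.NoSmallDeadStrictHighSkewJointTailsDeep` (home `FreezeCutDeadClasses`) superseding the rev-4 sub-class
pair; decided cells are THEOREMS and
are not filed.

## This file

§K7 classes (lens-3 g19 rev 4, cone-free, `section BookingDead` of `…Theorems.FreezeCut`): the seven typed
sub-classes of the rev-2 residual `NoHighSkewJointTailsDeep` — `NoLooseHighSkewJointTailsDeep` (DECIDED by D4),
`NoSmallDeadHighSkewJointTailsDeep`, `NoBoundarySkewJointTailsDeep`, `NoStrictHighSkewJointTailsDeep`,
`NoUnbalancedBoundaryTailsDeep` (DECIDED by D7), `NoBalancedBoundaryTailsDeep` (the class g20 decides modulo the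
port), **`NoSmallDeadStrictHighSkewJointTailsDeep`** (THE LOCATED RESIDUAL of the lens-3 column after g20 — the ONE
live aside, home = this file).  Definitions only; imports `FreezeCutClasses` (cone-free: importable by the route file).

[WRITER NOTE (decomp-res writer g9): file split only (tree files ≤ 400 lines); namespaces, sections, section
variables and every declaration
exactly as in the lens (the lens's global opens are replayed per file; cone-free files carry the opens of
`FreezeCutClasses.lean`, the toric kernel none).]

(Sources: Kollar2007 (Lectures on Resolution of Singularities: Thm 1.93, Def 2.56, Rem 2.57, Claim 2.59.1, (2.59.2),
Claim 2.59.4) [corpus:book:kollar2007-lectures-resolution-singularities pp. 54, 92–94]; Hauser2010Kangaroo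
(arXiv:0811.4151); Moh1987; CossartPiltant2008 §2; CossartPiltant2019 Prop. 2.50; HauserPerlega2019 §1.)
-/

noncomputable section

open MvPolynomial Finset
open Literature.AlgebraicGeometry.Resolution
open Literature.AlgebraicGeometry.Resolution.Hauser2010
open Literature.AlgebraicGeometry.Resolution.PointBlowup
open Literature.AlgebraicGeometry.Resolution.WeightedBlowup
open Summit.ResolutionOfSingularities.ResolutionOfSingularities.Theorems.TightDefectClasses
open Summit.ResolutionOfSingularities.ResolutionOfSingularities.Theorems.ProximityCut
open Summit.ResolutionOfSingularities.ResolutionOfSingularities.Theorems.TightCut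
open Summit.ResolutionOfSingularities.ResolutionOfSingularities.Theorems.HoleCut

namespace Summit.ResolutionOfSingularities.ResolutionOfSingularities.Theorems.FreezeCut

section BookingDead

/-! ## §K7 BOOKING OF THE DEAD-SUPPORT AND BALANCE LAWS (g19 rev 4) — TWO TYPED SUB-CLASSES OF THE RESIDUAL
DECIDED BY A NON-BAND CRITERION; THE RESIDUAL `NoHighSkewJointTailsDeep` RE-LOCATED EXACTLY TO «SMALL-DEAD» TAILS AND ITS
BOUNDARY-LINE CELL TO «BALANCED» TAILS

No band is consumed here: the dead-support law D4 holds at every `(p^e, s)`, the balance law D7 on the whole boundary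
line.  DECIDED (EMPTY): the high-shade skew joint tails with a LOOSE stage beyond every bound (a stage that is not
small or carries no dead support), and the boundary-line skew joint tails with an UNBALANCED stage beyond every bound.
RESIDUAL: `NoSmallDeadHighSkewJointTailsDeep` (every stage small with a dead support) — EXACTLY equivalent to
`NoHighSkewJointTailsDeep`, hence to lens-5's `NoSkewJointTailsDeep`; on the boundary line `p^e + 1 = 2s` the cell is
EXACTLY «no BALANCED skew joint tail» (`r` a permutation of `(0, s−1, s−1)` and `D = p^e − 1` at every stage). -/

/-- **DECIDED SUB-CLASS (EMPTY, PROVED — non-band criterion).**  High-shade skew joint tails (all binders of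
`NoHighSkewJointTailsDeep`) having, beyond every bound, a LOOSE stage: one that is not small (`s ≤ r_y` for some `y`)
or carries no dead support (no cone variable of multiplicity `0`; `ConeVar` inlined).  Empty by the dead-support law
(D4) — at every `(p^e, s)`. [new] -/
def NoLooseHighSkewJointTailsDeep : Prop :=
  ∀ p : ℕ, p.Prime → ∀ e : ℕ, 2 ≤ e → ∀ (K : Type) [Field K] [CharP K p] [PerfectField K] [DecidableEq K]
    (s₀ : State (Fin 3) K), IsRoot (p ^ e) s₀ → ∀ W : ForcedWalk (p ^ e) s₀, (∀ i, 1 ≤ (W.st i).shade) →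
    ∀ N : ℕ, (∀ t, N ≤ t → (W.st (t + 1)).shade = (W.st t).shade) →
    (∀ t, N ≤ t → ordZero (W.st t).F ≠ ((p ^ e : ℕ) : ℕ∞)) → (∀ M : ℕ, ∃ t, M ≤ t ∧ StaysOnNewest W t) →
    (∀ M : ℕ, ∃ t, M ≤ t ∧ W.b t ≠ 0) →
    ∀ s : ℕ, (W.st N).shade = (s : ℕ∞) → 3 ≤ s → p ^ e + 3 ≤ 3 * s → p ^ e + 1 ≤ 2 * s →
    (∀ (k : Fin 3) (N' : ℕ), ∃ t, N' ≤ t ∧ (W.j t = k ∨ W.b t k ≠ 0)) →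
    (∀ M : ℕ, ∃ t, M ≤ t ∧ ¬ ((∀ y, (W.st t).r y + 1 ≤ s) ∧ ∃ x, (W.st t).r x = 0 ∧
      ∃ d ∈ (W.st t).F.support, ((d.degree : ℕ) : ℕ∞) = ordZero (W.st t).F ∧ (W.st t).r x < d x)) → False

/-- **THE RESIDUAL AFTER rev 4 — SMALL-DEAD HIGH-SHADE SKEW JOINT TAILS.**  All binders of `NoHighSkewJointTailsDeep`
AND: every stage from `N` on is SMALL (`r_y ≤ s − 1` for all `y`) and carries a DEAD SUPPORT (a cone variable of
multiplicity `0`; `ConeVar` inlined).  EXACTLY equivalent to `NoHighSkewJointTailsDeep` (`highSkew_iff_smallDead`). [new] -/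
def NoSmallDeadHighSkewJointTailsDeep : Prop :=
  ∀ p : ℕ, p.Prime → ∀ e : ℕ, 2 ≤ e → ∀ (K : Type) [Field K] [CharP K p] [PerfectField K] [DecidableEq K]
    (s₀ : State (Fin 3) K), IsRoot (p ^ e) s₀ → ∀ W : ForcedWalk (p ^ e) s₀, (∀ i, 1 ≤ (W.st i).shade) →
    ∀ N : ℕ, (∀ t, N ≤ t → (W.st (t + 1)).shade = (W.st t).shade) →
    (∀ t, N ≤ t → ordZero (W.st t).F ≠ ((p ^ e : ℕ) : ℕ∞)) → (∀ M : ℕ, ∃ t, M ≤ t ∧ StaysOnNewest W t) →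
    (∀ M : ℕ, ∃ t, M ≤ t ∧ W.b t ≠ 0) →
    ∀ s : ℕ, (W.st N).shade = (s : ℕ∞) → 3 ≤ s → p ^ e + 3 ≤ 3 * s → p ^ e + 1 ≤ 2 * s →
    (∀ (k : Fin 3) (N' : ℕ), ∃ t, N' ≤ t ∧ (W.j t = k ∨ W.b t k ≠ 0)) →
    (∀ t, N ≤ t → ((∀ y, (W.st t).r y + 1 ≤ s) ∧ ∃ x, (W.st t).r x = 0 ∧
      ∃ d ∈ (W.st t).F.support, ((d.degree : ℕ) : ℕ∞) = ordZero (W.st t).F ∧ (W.st t).r x < d x)) → False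

/-- THE BOUNDARY-LINE CELL of the residual: `p^e + 1 = 2s` (cells `(5,3), (7,4), (9,5), (11,6), (13,7), …`). [new] -/
def NoBoundarySkewJointTailsDeep : Prop :=
  ∀ p : ℕ, p.Prime → ∀ e : ℕ, 2 ≤ e → ∀ (K : Type) [Field K] [CharP K p] [PerfectField K] [DecidableEq K]
    (s₀ : State (Fin 3) K), IsRoot (p ^ e) s₀ → ∀ W : ForcedWalk (p ^ e) s₀, (∀ i, 1 ≤ (W.st i).shade) →
    ∀ N : ℕ, (∀ t, N ≤ t → (W.st (t + 1)).shade = (W.st t).shade) →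
    (∀ t, N ≤ t → ordZero (W.st t).F ≠ ((p ^ e : ℕ) : ℕ∞)) → (∀ M : ℕ, ∃ t, M ≤ t ∧ StaysOnNewest W t) →
    (∀ M : ℕ, ∃ t, M ≤ t ∧ W.b t ≠ 0) →
    ∀ s : ℕ, (W.st N).shade = (s : ℕ∞) → 3 ≤ s → p ^ e + 3 ≤ 3 * s → p ^ e + 1 = 2 * s →
    (∀ (k : Fin 3) (N' : ℕ), ∃ t, N' ≤ t ∧ (W.j t = k ∨ W.b t k ≠ 0)) → False

/-- THE STRICT CELLS of the residual: `p^e + 2 ≤ 2s`. [new] -/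
def NoStrictHighSkewJointTailsDeep : Prop :=
  ∀ p : ℕ, p.Prime → ∀ e : ℕ, 2 ≤ e → ∀ (K : Type) [Field K] [CharP K p] [PerfectField K] [DecidableEq K]
    (s₀ : State (Fin 3) K), IsRoot (p ^ e) s₀ → ∀ W : ForcedWalk (p ^ e) s₀, (∀ i, 1 ≤ (W.st i).shade) →
    ∀ N : ℕ, (∀ t, N ≤ t → (W.st (t + 1)).shade = (W.st t).shade) →
    (∀ t, N ≤ t → ordZero (W.st t).F ≠ ((p ^ e : ℕ) : ℕ∞)) → (∀ M : ℕ, ∃ t, M ≤ t ∧ StaysOnNewest W t) →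
    (∀ M : ℕ, ∃ t, M ≤ t ∧ W.b t ≠ 0) →
    ∀ s : ℕ, (W.st N).shade = (s : ℕ∞) → 3 ≤ s → p ^ e + 3 ≤ 3 * s → p ^ e + 2 ≤ 2 * s →
    (∀ (k : Fin 3) (N' : ℕ), ∃ t, N' ≤ t ∧ (W.j t = k ∨ W.b t k ≠ 0)) → False

/-- **DECIDED SUB-CLASS ON THE BOUNDARY LINE (EMPTY, PROVED — non-band criterion).**  Boundary-line skew joint tails
having, beyond every bound, an UNBALANCED stage (boundary mass `≠ p^e − 1`, or multiplicities not a permutation of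
`(0, s−1, s−1)`).  Empty by the balance law (D7). [new] -/
def NoUnbalancedBoundaryTailsDeep : Prop :=
  ∀ p : ℕ, p.Prime → ∀ e : ℕ, 2 ≤ e → ∀ (K : Type) [Field K] [CharP K p] [PerfectField K] [DecidableEq K]
    (s₀ : State (Fin 3) K), IsRoot (p ^ e) s₀ → ∀ W : ForcedWalk (p ^ e) s₀, (∀ i, 1 ≤ (W.st i).shade) →
    ∀ N : ℕ, (∀ t, N ≤ t → (W.st (t + 1)).shade = (W.st t).shade) →
    (∀ t, N ≤ t → ordZero (W.st t).F ≠ ((p ^ e : ℕ) : ℕ∞)) → (∀ M : ℕ, ∃ t, M ≤ t ∧ StaysOnNewest W t) →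
    (∀ M : ℕ, ∃ t, M ≤ t ∧ W.b t ≠ 0) →
    ∀ s : ℕ, (W.st N).shade = (s : ℕ∞) → 3 ≤ s → p ^ e + 3 ≤ 3 * s → p ^ e + 1 = 2 * s →
    (∀ (k : Fin 3) (N' : ℕ), ∃ t, N' ≤ t ∧ (W.j t = k ∨ W.b t k ≠ 0)) →
    (∀ M : ℕ, ∃ t, M ≤ t ∧ ¬ ((W.st t).r.degree + 1 = p ^ e ∧ ∃ x, (W.st t).r x = 0 ∧ ∀ y, y ≠ x → (W.st t).r y + 1 = s)) → False

/-- **THE RESIDUAL OF THE BOUNDARY-LINE CELL — BALANCED SKEW JOINT TAILS**: every stage from `N` on has boundary mass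
`p^e − 1` and multiplicity vector a permutation of `(0, s−1, s−1)` (the universal balanced cycle of the shadow
automaton, now a kernel statement about walks).  EXACTLY the boundary cell (`boundarySkew_iff_balanced`). [new] -/
def NoBalancedBoundaryTailsDeep : Prop :=
  ∀ p : ℕ, p.Prime → ∀ e : ℕ, 2 ≤ e → ∀ (K : Type) [Field K] [CharP K p] [PerfectField K] [DecidableEq K]
    (s₀ : State (Fin 3) K), IsRoot (p ^ e) s₀ → ∀ W : ForcedWalk (p ^ e) s₀, (∀ i, 1 ≤ (W.st i).shade) →
    ∀ N : ℕ, (∀ t, N ≤ t → (W.st (t + 1)).shade = (W.st t).shade) →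
    (∀ t, N ≤ t → ordZero (W.st t).F ≠ ((p ^ e : ℕ) : ℕ∞)) → (∀ M : ℕ, ∃ t, M ≤ t ∧ StaysOnNewest W t) →
    (∀ M : ℕ, ∃ t, M ≤ t ∧ W.b t ≠ 0) →
    ∀ s : ℕ, (W.st N).shade = (s : ℕ∞) → 3 ≤ s → p ^ e + 3 ≤ 3 * s → p ^ e + 1 = 2 * s →
    (∀ (k : Fin 3) (N' : ℕ), ∃ t, N' ≤ t ∧ (W.j t = k ∨ W.b t k ≠ 0)) →
    (∀ t, N ≤ t → ((W.st t).r.degree + 1 = p ^ e ∧ ∃ x, (W.st t).r x = 0 ∧ ∀ y, y ≠ x → (W.st t).r y + 1 = s)) → False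

/-- THE RESIDUAL OF THE STRICT CELLS — small-dead skew joint tails at `p^e + 2 ≤ 2s`. [new] -/
def NoSmallDeadStrictHighSkewJointTailsDeep : Prop :=
  ∀ p : ℕ, p.Prime → ∀ e : ℕ, 2 ≤ e → ∀ (K : Type) [Field K] [CharP K p] [PerfectField K] [DecidableEq K]
    (s₀ : State (Fin 3) K), IsRoot (p ^ e) s₀ → ∀ W : ForcedWalk (p ^ e) s₀, (∀ i, 1 ≤ (W.st i).shade) →
    ∀ N : ℕ, (∀ t, N ≤ t → (W.st (t + 1)).shade = (W.st t).shade) →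
    (∀ t, N ≤ t → ordZero (W.st t).F ≠ ((p ^ e : ℕ) : ℕ∞)) → (∀ M : ℕ, ∃ t, M ≤ t ∧ StaysOnNewest W t) →
    (∀ M : ℕ, ∃ t, M ≤ t ∧ W.b t ≠ 0) →
    ∀ s : ℕ, (W.st N).shade = (s : ℕ∞) → 3 ≤ s → p ^ e + 3 ≤ 3 * s → p ^ e + 2 ≤ 2 * s →
    (∀ (k : Fin 3) (N' : ℕ), ∃ t, N' ≤ t ∧ (W.j t = k ∨ W.b t k ≠ 0)) →
    (∀ t, N ≤ t → ((∀ y, (W.st t).r y + 1 ≤ s) ∧ ∃ x, (W.st t).r x = 0 ∧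
      ∃ d ∈ (W.st t).F.support, ((d.degree : ℕ) : ℕ∞) = ordZero (W.st t).F ∧ (W.st t).r x < d x)) → False

end BookingDead

end Summit.ResolutionOfSingularities.ResolutionOfSingularities.Theorems.FreezeCut
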